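import Literature.MathematicalPhysics.QuantumFieldTheory.Balaban1983to89.B9Thm313WholeDvFromDds

/-!
# `Balaban1983to89.B9Thm313WholeDvsFromDdAnyNorm` — [B9] Thm 3.13 p. 426 + (3.8) p. 392 ∕ (3.3) p. 390: THE WORD `D\*_U ∘ T` FROM THE DIRECTION MEMBERS `∇_{U,ν} ∘ T` AND THE
# LETTER `J†_ν` (`D\*_U = Σ_ν J†_ν ∘ ∇_{U,ν}`), ANY BLOCK NORMS — the divergence-side MIRROR of dag-n06-c's `B9Thm313WholeDvFromDdsAnyNorm.word_dv_of_members`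
# (there `A ∘ D_U` from `A ∘ ∇\*_{U,μ}` and `J_μ`, `D_U = Σ_μ ∇\*_{U,μ} ∘ J_μ`)

T. Bałaban, *Propagators for lattice gauge theories in a background field*, Commun. Math. Phys. **99** (1985) 389–434 [`Balaban1985BackgroundPropagators`];
[4] = T. Bałaban, *Propagators and renormalization transformations for lattice gauge theories. II*, Commun. Math. Phys. **96** (1984) 223–250 [`Balaban1984PropagatorsII`].
statement-level skeleton of published theorems with citation tags; proofs where landed; nothing here is a claim about the Yang–Mills mass gap.

WHY THIS FILE (cell `pub-ymgap`, node N06, bundle F7 rows 20–21, seat dag-n06-l g32; programme P-HRGDD leg (D) step 4, HOME `P-HRGDD-LEG-D-MEMO.md`).  The supply of the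
certificate's displayed letter `hrgdd13` (`R ∘ D\*_U ∘ G₁ ∘ ∇\*_{U,μ}`, lossy Hölder species) splits `D\*_U = Σ_ν J†_ν ∘ ∇_{U,ν}` (`B9DivViaGradLettersAtPins.DvscoKH_eq_sum` at the
pins): per direction, `∇_{U,ν} ∘ T` (`T = G₁∇\*_μ`) is closed INTO the transported bond class from its (3.44)∕(3.45) members (`B9Thm313WholeG1PairMembersRegular` +
`B9SmoothHolderClassPClosure`), the letter `J†_ν` carries that class INTO the transported site class (dag-n06-c g22, `B9DivLetterTransportedInputClasses.hasMaj_JTcoKH_bHZKP_bHZP`),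
and THIS FILE sums: ★★ `word_dvs_of_members` — from `hDvs : Dvs = Σ ν, JT ν ∘ₗ Dd ν`, members `hV : ∀ ν, HasMaj b₁ b₂ (Dd ν ∘ₗ T) (Bᵥ·e^{−δ₁d})` and letters
`hJT : ∀ ν, HasMaj b₂ b₃ (JT ν) (C_J·e^{−δ_J d})`, for ANY classes `b₁ b₂ b₃`: `HasMaj b₁ b₃ (Dvs ∘ₗ T) (B·e^{−ρd})` with `B ≥ |P|·κ₂·C_J·Bᵥ·c`, `0 ≤ ρ ≤ δ₁`, `ρ + σ ≤ δ_J`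
([4] (2.52)–(2.56) composition through the middle class at its cutting cost, Lemma 2.1's row sum at the margin σ); `dvs_comp_eq_fsum` is the algebraic split.
HONEST SCOPE.  Majorant algebra; members and letters are HYPOTHESES; nothing of [B9]∕[4] asserted; no pin, no certificate edit; COUNT-NEUTRAL; N06 NOT discharged; nothing
continuum ∕ OS ∕ mass gap ∕ Clay.  NEW file; cell `pub-ymgap` (HUMAN RULING D-0062), Track A node N06 [B9], seat `pub-ymgap-dag-n06-l` (g32), 2026-08-30.
-/

namespace Literature.MathematicalPhysics.QuantumFieldTheory.Balaban1983to89.B9Thm313WholeDvsFromDdAnyNorm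

open Finset B6RandomWalk B6RandomWalkHom B9Thm34Ext B11SectG B9SectDSup B9Thm312Whole
open B9Thm313WholeDvFromDds (hasMaj_fsum_const)

noncomputable section

variable {g : B9.Geometry} {X W P : Type} [Fintype P] [Fintype g.Site]
variable {R₀ : ℝ} {H₀ : Prop}

omit [Fintype g.Site] in
/-- the algebraic split `D\*_U ∘ T = Σ_ν J†_ν ∘ (∇_{U,ν} ∘ T)` from `D\*_U = Σ_ν J†_ν ∘ ∇_{U,ν}`. [cite: Balaban1985BackgroundPropagators, (3.8) p.392 (bookkeeping)] -/
theorem dvs_comp_eq_fsum {V : Type} {Dd : P → Module.End ℝ (X → ℝ)} {JT : P → (X → ℝ) →ₗ[ℝ] (W → ℝ)} {Dvs : (X → ℝ) →ₗ[ℝ] (W → ℝ)}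
    (hDvs : Dvs = ∑ ν, JT ν ∘ₗ Dd ν) (T : (V → ℝ) →ₗ[ℝ] (X → ℝ)) : Dvs ∘ₗ T = ∑ ν, JT ν ∘ₗ (Dd ν ∘ₗ T) := by
  rw [hDvs]
  apply LinearMap.ext
  intro f
  simp only [LinearMap.comp_apply, LinearMap.sum_apply]

/-- ★★ **THE WORD `D\*_U ∘ T` FROM THE DIRECTION MEMBERS `∇_{U,ν} ∘ T` AND THE LETTERS `J†_ν`, ANY BLOCK NORMS**: `hV : ∀ ν, HasMaj b₁ b₂ (Dd ν ∘ T) (Bᵥ·e^{−δ₁d})` (the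
direction members of `T` INTO the middle class), `hJT : ∀ ν, HasMaj b₂ b₃ (JT ν) (C_J·e^{−δ_J d})` (the letter INTO the target class), `Dvs = Σ ν, JT ν ∘ Dd ν` ⟹
`HasMaj b₁ b₃ (Dvs ∘ T) (B·e^{−ρd})` for `0 ≤ ρ ≤ δ₁`, `ρ + σ ≤ δ_J`, `|P|·κ₂·C_J·Bᵥ·c ≤ B` — the mirror of `B9Thm313WholeDvFromDdsAnyNorm.word_dv_of_members`.
[cite: Balaban1985BackgroundPropagators, Thm 3.13 (3.153) p.426 + (3.8) p.392 + (3.44)–(3.45) p.398; Balaban1984PropagatorsII, (2.52)–(2.56) pp.232–233 + Lemma 2.1 (2.61) p.234] -/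
theorem word_dvs_of_members (hG : GeoOK g) {σ c : ℝ} (hrow : RowSum (toB6 g R₀ H₀) σ c)
    {V F₃ : Type} [AddCommGroup F₃] [Module ℝ F₃]
    {b₁ : BlockNorm (toB6 g R₀ H₀) (V → ℝ)} {b₂ : BlockNorm (toB6 g R₀ H₀) (X → ℝ)} {b₃ : BlockNorm (toB6 g R₀ H₀) F₃}
    {T : (V → ℝ) →ₗ[ℝ] (X → ℝ)} {Dd : P → Module.End ℝ (X → ℝ)} {JT : P → (X → ℝ) →ₗ[ℝ] F₃} {Dvs : (X → ℝ) →ₗ[ℝ] F₃}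
    {BV δ₁ CJ δJ ρ B : ℝ} (hBV : 0 ≤ BV) (hCJ : 0 ≤ CJ) (hρ : 0 ≤ ρ) (hρ₁ : ρ ≤ δ₁) (hρJ : ρ + σ ≤ δJ)
    (hB : (Fintype.card P : ℝ) * (b₂.κ * CJ * BV * c) ≤ B)
    (hDvs : Dvs = ∑ ν, JT ν ∘ₗ Dd ν)
    (hV : ∀ ν, HasMaj b₁ b₂ (Dd ν ∘ₗ T) (fun (a b : g.Site) => BV * Real.exp (-(δ₁ * g.dist a b))))
    (hJT : ∀ ν, HasMaj b₂ b₃ (JT ν) (fun (a b : g.Site) => CJ * Real.exp (-(δJ * g.dist a b)))) :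
    HasMaj b₁ b₃ (Dvs ∘ₗ T) (fun (a b : g.Site) => B * Real.exp (-(ρ * g.dist a b))) := by
  have htri : Triangle254 (toB6 g R₀ H₀) := fun a b c => hG.tri a b c
  have h2 : ∀ ν ∈ (Finset.univ : Finset P), HasMaj b₁ b₃ (JT ν ∘ₗ (Dd ν ∘ₗ T))
      (fun (a b : g.Site) => b₂.κ * CJ * BV * c * Real.exp (-(ρ * g.dist a b))) :=
    fun ν _ => (hasMaj_comp_exp htri (fun a b => hG.dnn a b) hrow hCJ hBV hρ hρ₁ hρJ (hJT ν) (hV ν)).mono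
      fun a b => le_of_eq (by simp only [toB6_dist])
  have hsplit : Dvs ∘ₗ T = ∑ ν, JT ν ∘ₗ (Dd ν ∘ₗ T) := by
    rw [hDvs]
    apply LinearMap.ext
    intro f
    simp only [LinearMap.comp_apply, LinearMap.sum_apply]
  rw [hsplit]
  refine (hasMaj_fsum_const _ _ _ h2).mono fun a b => ?_
  rw [Finset.card_univ]
  calc (Fintype.card P : ℝ) * (b₂.κ * CJ * BV * c * Real.exp (-(ρ * g.dist a b)))
      = (Fintype.card P : ℝ) * (b₂.κ * CJ * BV * c) * Real.exp (-(ρ * g.dist a b)) := by ring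
    _ ≤ B * Real.exp (-(ρ * g.dist a b)) := mul_le_mul_of_nonneg_right hB (Real.exp_nonneg _)

end

end Literature.MathematicalPhysics.QuantumFieldTheory.Balaban1983to89.B9Thm313WholeDvsFromDdAnyNorm
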